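import Summits.HodgeConjecture.HodgeConjecture.Theorems.F0P6aDatumOfInputsDefs
import Literature.AlgebraicGeometry.AbelianSchemes.RoofLegsSpecialFibreKernelRowsFinImage
import HarnessLib
import HarnessLib.Audit.LibrarySuggestionsDenyListCruxes

/-!
# `F0P6aRoofLegsFinImage` — ★ RE-HOME (K6) of the crux workfile `Lines/F0_P6a_RoofLegsFinImage.lean`

This `Theorems/` module is the TREE BYTES of `Summits/HodgeConjecture/HodgeConjecture/Cruxes/HLiu418/Lines/F0_P6a_RoofLegsFinImage.lean` (edition of record, tree sha16 1b47322c605b8671,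
187 l., 1 declaration: `exists_roofLeg_of_legs_kerRowsFin_image`; code-`sorry`-free) with the NAMESPACE KEPT — `Summit.HodgeConjecture.HodgeConjecture.Cruxes.HLiu418.F0P6aLineSpecialisation` —
so that every fully-qualified name is UNCHANGED; only this module docstring is re-headed, the header is CANONICAL (bare `import` lines; LEAD F0P6-plan (g6) «M-142a» (A)),
the `Lines` imports are switched to their ★ re-homed twins (`Lines.F0_P6a_DatumOfInputs` → ★ `Theorems.F0P6aDatumOfInputsDefs`), and the `Cruxes` deny-list carrier is kept on this
root part («P-κ», «M-142d» (1)).  Why a re-home: a `Theorems/` file cannot import a `Lines/` workfile (F0P6-ref1 o-6), and closing stmt-HodgeConjecture-24832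
`--as proved --by <Theorems decl>` at rung 0 needs the sorry-free `Lines` chain behind the gate (RE-HOME TABLE v1.7, LA7-plan (g7); PLAN «L2 cone RE-HOME» v1.4, LA2-plan (g5);
LEAD F0P6-plan (g6) «M-142a» (B), 2026-09-02).  After the chain is ★ the `Lines` workfile becomes a one-import SHIM of `Theorems.F0P6aRoofLegsFinImage` (a `Lines/` write, batched per cone
on the LEAD՚s word), so no environment holds two copies (NO-CROSS-IMPORT, «M-72» (3)).  It asserts nothing beyond what the workfile already proves.
HC_CM is proved only modulo the 7 printed citations (2 remaining: hLiu418 = stmt-HodgeConjecture-24832, h413 = stmt-HodgeConjecture-24833) until rung 0 closes; a re-home is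
count-neutral.  (Cand: LA2-p03 (g7), HOME-only, generator `k6/mk_twin.py`.)

## Import provenance (the workfile՚s header comments, moved here so that the header is CANONICAL)
- `Summits.HodgeConjecture.HodgeConjecture.Theorems.F0P6aDatumOfInputsDefs` — ★ twin (LAST part, plain stem) of `Lines.F0_P6a_DatumOfInputs`  ∕ was: -- D-LINE (served): `RGDInputsAt`, carriers `schΩOf`∕`fibreΩOf`, `IsIdealTorsionΩ`, …
- `Literature.AlgebraicGeometry.AbelianSchemes.RoofLegsSpecialFibreKernelRowsFinImage` — ★ A-p06 (g37): the Fin + Image legs for ONE `q̄` (imports ★ p850352's Deg chain + ★ p850875 §0 + ★ p851262)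
- `HarnessLib`
- `HarnessLib.Audit.LibrarySuggestionsDenyListCruxes` — «P-κ» (LEAD F0P6-plan (g6) «M-142d» (1)): ROOT part keeps the `Cruxes` deny-list carrier  ∕ was: -- [v4] build-lane export guard (operator companion, req547; LEAD «M-119b»∕«M-119c»): deny-list entry "Cruxes" for the LibrarySuggestions export fold — ADD-ONLY, no statement/proof/axiom affected

## Original module docstring (verbatim)
# F0 · P6a — ④-bis LEAFLET `Cruxes/HLiu418/Lines/F0_P6a_RoofLegsFinImage.lean`: THE REDUCED ROOF LEG AT THE D-LINE BINDERS WITH ITS KERNEL ∕ DEGREE ∕ FINITENESS ∕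
# RANK ROWS AND THE IMAGE ROW, IN ONE ∃ (ED. 1 cand v2; pen A-p06 (g37); consumer `Lines/F0_P6a_StubRHO1.lean` — LA2-plan (g2) RULING 2026-09-02T14:10:00Z (1)(3))

`crux_decl: Summit.HodgeConjecture.HodgeConjecture.Theses.HCCMUnconditional.HLiu418`.  Cell `hodgecm-mathlib` (D-0151), «GO 500» half A line L2 (socket `stub_DOWN` → LEAF
`Lines/F0_P6a_StubDOWN.lean` → `stub_RHO1`).  Namespace `Summit.HodgeConjecture.HodgeConjecture.Cruxes.HLiu418.F0P6aLineSpecialisation` (the `StubRHO1` leaflet's; FQN census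
vs every served leaflet = ∅, LA2-p03 (g3) 11:50:58Z); imports the served D-LINE + ★ only; 0 sorry; ONE theorem **`exists_roofLeg_of_legs_kerRowsFin_image`** = W1-a ④
`F0P6aStubFROBRoofLegs.exists_roofLeg_of_legs_kerRows` (`Lines/F0_P6a_StubFROBRoofLegs.lean` :112; binders and the nine conjuncts (r1₀)(r4₀-q)(r5₀-q)(r3₀-q ∀)(K3₀)(K2₀)
(K4₀)(FIN₀)(RK₀) VERBATIM, so every ④-consumer projection path is unchanged) with the (IMG-gen) conjunct of A-p06 (g36) (b″) APPENDED LAST, proved by the bare call of ★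
`exists_roofLeg_specialFibre_of_downstairsDual_kerRowsFin_image` (★ `RoofLegsSpecialFibreKernelRowsFinImage`, A-p06 (g37) p851284).  BUDGET: every decl ≤ 400 000 (the law; measured 134 688 kHB ∕ 28.6 s by LA2-p03 (g4) (c4′) on v9).  KEY (A-p06 (g37) diff diagnostic 2026-09-02T13:48Z):
the two instances are NAMED BINDERS `[hC : IsCommMonObj I.univ.X] [hPr : IsProper (𝓜.localise w).total.hom]` (LEAD «M-105» (R1); a caller whose socket inlines `I.comm`∕`h𝓨.2` passes them BY NAME `(hC := I.comm) (hPr := h𝓨.2)` per (R3)) (no `haveI := I.comm ∕ h𝓨.2` prefix in the statement) and the proof is the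
bare ★ TERM, so statement and proof carry the SAME instance subterms and the ten-row conclusion unifies syntactically (with tactic-mode `haveI` the ★ call carried
opaque instance fvars and the unification walked the whole term: ✗ 400 000 ∕ ✗ 480 000 ∕ ✓ 560 000).  OWN leaflet (LA2-plan (g2) RULING 14:10:00Z (3)): 0 importers
until `Lines/F0_P6a_StubRHO1.lean`; ④ stays ED. 1 (LA3-plan (g2) 11:26:23Z).
WHY (LA1-plan (g5) ∕ LA2-plan (g2) ∕ LA1-p02 (g3) 2026-09-02T11:17–12:01Z, RULING (γ1) «ONE ∃, ONE ROOF DOWNSTAIRS»): the (ρ1𝒞) body `exists_quotLegReduction_of_legs` names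
ONE reduced leg `ψOf := (exists_qbar_of_legs …).choose`; its rows (RK)∕(DOCK) consume (K4₀)(FIN₀)(RK₀) and its row (IMG) consumes (IMG-gen) — of the SAME witness; ④ (Fin
chain, ★ p850352) has no (IMG-gen), (b″) (image chain, ★ p850875) has no (K4₀)(FIN₀)(RK₀).
HC_CM is proved only modulo the 7 printed citations (2 remaining: hLiu418 = stmt-HodgeConjecture-24832, h413 = stmt-HodgeConjecture-24833) until rung 0 closes; count-neutral.
[cite: Liu2021, Prop. D.8 (3) p. 135, pp. 136–138] [cite: SerreTate1968, §1] [cite: MumfordAV1970, §23 Thm. 2 (p. 231)] [cite: BoschLutkebohmertRaynaud1990, §2.5 Prop. 2, §7.3 Prop. 6 (p. 180)]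
-/

set_option autoImplicit false

noncomputable section

namespace Summit.HodgeConjecture.HodgeConjecture.Cruxes.HLiu418.F0P6aLineSpecialisation

set_option linter.dupNamespace false

open CategoryTheory CategoryTheory.Limits NumberField IsDedekindDomain MulAction AlgebraicGeometry
open scoped Matrix Pointwise MonObj
open Literature.NumberTheory.GaloisRepresentations
open Literature.NumberTheory.Automorphic Literature.NumberTheory.Automorphic.UnitaryGroup
open Literature.AlgebraicGeometry.ShimuraVarieties.UnitaryCanonicalModel
open Literature.NumberTheory.Automorphic.Liu2021.AppendixC
open Literature.AlgebraicGeometry.Motives (AlgPoints IntegralModel SchemeOver thickening thickeningLift specOver relFrobeniusOver frobSpec)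
open Literature.NumberTheory.DiophantineGeometry (geomResidueField specialFibreFunctor specResidueField)
open Literature.AlgebraicGeometry.RelativeSpec (ActionOver)
open Literature.NumberTheory.EllipticCurves (genericFibre specGenericPoint)
open Literature.AlgebraicGeometry.AbelianSchemes Literature.AlgebraicGeometry.AbelianSchemes.AbelianSchemeOver
open Summit.HodgeConjecture.HodgeConjecture.Cruxes.HLiu418.F0P6aModuliDatumDefs
open Summit.HodgeConjecture.HodgeConjecture.Cruxes.HLiu418.F0P6aRGDAssembly
open Summit.HodgeConjecture.HodgeConjecture.Cruxes.HLiu418.F0P6aDatumOfInputs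

set_option backward.isDefEq.respectTransparency false

variable {F : Type} [Field F] [NumberField F] [IsCMField F] {ι₁ : F →+* ℂ}
    {Jstar : Matrix (Fin 2) (Fin 2) F}
    {K₀ : C5.OpenCompactSubgroup ↥(finAdelic ↥(maximalRealSubfield F) F (IsCMField.complexConj F) 2 Jstar)}
    {S : RecordSystemGS F Jstar ι₁ K₀} {hU7ₛ : S.HeckeTranslateDefinedOver}
    {hJ : (Jstar.map (IsCMField.complexConj F))ᵀ = Jstar} {hJu : IsUnit Jstar}
    {Fi : Type} [Field Fi] [Algebra F Fi] {Kc : C5.SmallLevel K₀} {G : Type} [Group G]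
    {𝓜 : IntegralModel (𝓞 F) F ((thickening F Fi).obj (S.M.obj Kc))}
    {w : HeightOneSpectrum (𝓞 F)} {hw : (IsCMField.complexConj F) • w ≠ w} {h𝓨 : (𝓜.localise w).IsSmoothProper 1}
    {θ : ActionOver (𝓜.localise w).total.hom ((Fi ≃ₐ[F] Fi) × G)}
    {e : Fi →ₐ[F] AlgebraicClosure (w.adicCompletion F)}

section KernelRowsFinImage

open Literature.NumberTheory.DiophantineGeometry
open Literature.AlgebraicGeometry.Motives (extendPoint specValuationSubring specFractionFieldι specRingHomι)

set_option maxHeartbeats 400000 in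
/-- (b‴) **④-bis — ★ `exists_roofLeg_specialFibre_of_downstairsDual_kerRowsFin_image` AT THE D-LINE CARRIERS, IN ★'s OWN CURRENCY: ④ (b′) :112 with the (IMG-gen) ROW
APPENDED LAST, for THE SAME `q̄`.**  Binders and the conjuncts (r1₀)(r4₀-q)(r5₀-q)(r3₀-q ∀)(K3₀)(K2₀)(K4₀)(FIN₀)(RK₀) = W1-a ④ `F0P6aStubFROBRoofLegs.exists_roofLeg_of_legs_kerRows`
VERBATIM (every projection path of a ④ consumer unchanged); ONE more conjunct, LAST: (IMG-gen) — for a flat `incl : 𝒦 → I.univ_ỹ` and a model subscheme `ζ : 𝒵 → I.univ_ỹ″`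
whose composite with the MODEL cover leg `ψ_P ×_𝓨 ỹ″` is a closed immersion, if `incl_η ≫ e⁻¹ ≫ q` factors through `ζ_η ≫ e⁻¹ ≫ c` then `incl_s̄ ≫ e⁻¹ ≫ q̄` factors through
`ζ_s̄ ≫ e⁻¹ ≫ c̄_{x̄″}` (A-p06 (g36) (b″) `exists_roofLeg_of_legs_kerRows_image` text VERBATIM) — the `hIMG` binder of § IMG's `himg_spGeoOf_of_roofRows[_of_sigma]` ∕ `row_IMG[_of_sigma]`.
WHY (LA1-plan (g5) ∕ LA2-plan (g2) ∕ LA1-p02 (g3) 2026-09-02T11:17–11:26Z, RULING (γ1) «ONE ∃, ONE ROOF DOWNSTAIRS»): the (ρ1𝒞) body `exists_quotLegReduction_of_legs` names ONE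
reduced leg `H.choose`; its rows (RK)∕(DOCK) consume (K4₀)(FIN₀)(RK₀) and its row (IMG) consumes (IMG-gen) — of the SAME witness; ④ (Fin chain, ★ p850352) has no (IMG-gen) and
(b″) (image chain, ★ p850875) has no (K4₀)(FIN₀)(RK₀); this is the bare call of the merged ★ `RoofLegsSpecialFibreKernelRowsFinImage` (A-p06 (g37)).  Tree home: §A of
`Lines/F0_P6a_StubRHO1.lean` (LA2-plan (g2) STATUS #9 (5); LA3-plan (g2) 11:26:23Z: ④ stays ED. 1).
[cite: Liu2021, Prop. D.8 (3) p. 135, pp. 136–138] [cite: SerreTate1968, §1] [cite: MumfordAV1970, §23 Thm. 2 (p. 231)] [cite: BoschLutkebohmertRaynaud1990, §2.5 Prop. 2] -/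
theorem exists_roofLeg_of_legs_kerRowsFin_image (I : RGDInputsAt F ι₁ Jstar K₀ S hU7ₛ hJ hJu Fi Kc G 𝓜 w hw h𝓨 θ e)
    -- the two instances as BINDERS (not `haveI := I.comm ∕ h𝓨.2` prefixes): statement and proof then carry the SAME instance terms, so the
    -- ten-row conclusion unification is syntactic (A-p06 (g37) diff diagnostic 13:48Z); NAMED per LEAD «M-105» (R1) so a caller may write `(hC := I.comm) (hPr := h𝓨.2)` (R3)
    [hC : IsCommMonObj I.univ.X] [hPr : IsProper (𝓜.localise w).total.hom]
    {m : ℕ} (E' : Matrix (Fin m) (Fin m) (𝓞 F)) (hE' : E' * E' = E') (P : Matrix (Fin m) (Fin 1) (𝓞 F)) (Q : Matrix (Fin 1) (Fin m) (𝓞 F))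
    (hP : E' * P = P) (hQ : Q * E' = Q) (hQP : Q * P = Matrix.scalar (Fin 1) (I.pChar : 𝓞 F))
    (hPQ : P * Q = Matrix.scalar (Fin m) (I.pChar : 𝓞 F) * E') (h𝔭 : Ideal.span (Set.range fun k => P k 0) = w.asIdeal)
    (hD : Nonempty ((Scheme.Modules.pullback (DualPair.unitHatSlice I.dual)).obj I.dual.P ≅ SheafOfModules.unit _))
    (y y'' : AlgPoints (S.M.obj Kc) (AlgebraicClosure (w.adicCompletion F)))
    {B : AbelianSchemeOver (Spec (CommRingCat.of (AlgebraicClosure (w.adicCompletion F))))}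
    (DB : B.DualPair) (lamB : B.X ⟶ DB.hat.X) [IsMonHom lamB]
    (hDBu : Nonempty ((Scheme.Modules.pullback DB.unitHatSlice).obj DB.P ≅ SheafOfModules.unit _))
    (q : (schΩOf S Kc 𝓜 w e I.univ y).X ⟶ B.X) [IsMonHom q] (c : (schΩOf S Kc 𝓜 w e I.univ y'').X ⟶ B.X) [IsMonHom c]
    [IsFinite q.left] [Surjective q.left] [Surjective c.left]
    -- (r2) the kernel of `c` on `Ω̄`-points is the `𝔭`-torsion
    (hr2 : ∀ Pt : ((I.univ.baseChange ((𝓜.localise w).genericIso'.inv.left ≫ pullback.fst (𝓜.localise w).total.hom (specGenericPoint (HeightOneSpectrum.valuationSubringAtPrime F w) F))).baseChange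
        (thickeningLift e (S.M.obj Kc) y'').left).toAffine.toAbelianVariety.Points (AlgebraicClosure (w.adicCompletion F)),
      (AlgPoints.map c Pt : B.toAffine.toAbelianVariety.Points (AlgebraicClosure (w.adicCompletion F))) = 1 ↔
        ∀ a ∈ w.asIdeal, (AlgPoints.map (((I.act.baseChange ((𝓜.localise w).genericIso'.inv.left ≫ pullback.fst (𝓜.localise w).total.hom
            (specGenericPoint (HeightOneSpectrum.valuationSubringAtPrime F w) F))).baseChange (thickeningLift e (S.M.obj Kc) y'').left).i a) Pt :
          ((I.univ.baseChange ((𝓜.localise w).genericIso'.inv.left ≫ pullback.fst (𝓜.localise w).total.hom (specGenericPoint (HeightOneSpectrum.valuationSubringAtPrime F w) F))).baseChange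
            (thickeningLift e (S.M.obj Kc) y'').left).toAffine.toAbelianVariety.Points (AlgebraicClosure (w.adicCompletion F))) = 1)
    -- (r3) the polarisation laws of the two legs through the dual homomorphism `λ_B`
    (hr3q : q ≫ lamB ≫ DualPair.dualIsogenyOver q
        ((I.dual.baseChange ((𝓜.localise w).genericIso'.inv.left ≫ pullback.fst (𝓜.localise w).total.hom (specGenericPoint (HeightOneSpectrum.valuationSubringAtPrime F w) F))).baseChange (thickeningLift e (S.M.obj Kc) y).left) DB =
      ((I.pol.baseChange ((𝓜.localise w).genericIso'.inv.left ≫ pullback.fst (𝓜.localise w).total.hom (specGenericPoint (HeightOneSpectrum.valuationSubringAtPrime F w) F))).baseChange (thickeningLift e (S.M.obj Kc) y).left).lam ≫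
        ((I.dual.baseChange ((𝓜.localise w).genericIso'.inv.left ≫ pullback.fst (𝓜.localise w).total.hom (specGenericPoint (HeightOneSpectrum.valuationSubringAtPrime F w) F))).baseChange (thickeningLift e (S.M.obj Kc) y).left).hat.mulN I.pChar)
    (hr3c : c ≫ lamB ≫ DualPair.dualIsogenyOver c
        ((I.dual.baseChange ((𝓜.localise w).genericIso'.inv.left ≫ pullback.fst (𝓜.localise w).total.hom (specGenericPoint (HeightOneSpectrum.valuationSubringAtPrime F w) F))).baseChange (thickeningLift e (S.M.obj Kc) y'').left) DB =
      ((I.pol.baseChange ((𝓜.localise w).genericIso'.inv.left ≫ pullback.fst (𝓜.localise w).total.hom (specGenericPoint (HeightOneSpectrum.valuationSubringAtPrime F w) F))).baseChange (thickeningLift e (S.M.obj Kc) y'').left).lam ≫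
        ((I.dual.baseChange ((𝓜.localise w).genericIso'.inv.left ≫ pullback.fst (𝓜.localise w).total.hom (specGenericPoint (HeightOneSpectrum.valuationSubringAtPrime F w) F))).baseChange (thickeningLift e (S.M.obj Kc) y'').left).hat.mulN I.pChar)
    -- (r4) common intertwiners
    (hr4 : ∀ a : 𝓞 F, ∃ b : B.X ⟶ B.X,
      ((I.act.baseChange ((𝓜.localise w).genericIso'.inv.left ≫ pullback.fst (𝓜.localise w).total.hom (specGenericPoint (HeightOneSpectrum.valuationSubringAtPrime F w) F))).baseChange (thickeningLift e (S.M.obj Kc) y).left).i a ≫ q =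
          q ≫ b ∧
        ((I.act.baseChange ((𝓜.localise w).genericIso'.inv.left ≫ pullback.fst (𝓜.localise w).total.hom (specGenericPoint (HeightOneSpectrum.valuationSubringAtPrime F w) F))).baseChange (thickeningLift e (S.M.obj Kc) y'').left).i a ≫ c =
          c ≫ b)
    -- (r5) level points correspond
    (hr5 : ∀ i : Fin I.g ⊕ Fin I.g → ZMod I.N,
      (AlgPoints.map q ((I.univ.baseChange ((𝓜.localise w).genericIso'.inv.left ≫ pullback.fst (𝓜.localise w).total.hom (specGenericPoint (HeightOneSpectrum.valuationSubringAtPrime F w) F))).restrictPt (thickeningLift e (S.M.obj Kc) y).left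
          (I.univ.sectionBaseChange ((𝓜.localise w).genericIso'.inv.left ≫ pullback.fst (𝓜.localise w).total.hom (specGenericPoint (HeightOneSpectrum.valuationSubringAtPrime F w) F)) (I.lvl.section_ i))) :
          B.toAffine.toAbelianVariety.Points (AlgebraicClosure (w.adicCompletion F))) =
        AlgPoints.map c ((I.univ.baseChange ((𝓜.localise w).genericIso'.inv.left ≫ pullback.fst (𝓜.localise w).total.hom (specGenericPoint (HeightOneSpectrum.valuationSubringAtPrime F w) F))).restrictPt (thickeningLift e (S.M.obj Kc) y'').left
          (I.univ.sectionBaseChange ((𝓜.localise w).genericIso'.inv.left ≫ pullback.fst (𝓜.localise w).total.hom (specGenericPoint (HeightOneSpectrum.valuationSubringAtPrime F w) F)) (I.lvl.section_ i)))) :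
    ∃ (qbar : ((I.univ.baseChange (pullback.fst (𝓜.localise w).total.hom (specResidueField w))).baseChange ((𝓜.localise w).geomReductionMap (thickeningLift e (S.M.obj Kc) y)).left).X ⟶
               (((serreTensor I.act E' hE').baseChange (pullback.fst (𝓜.localise w).total.hom (specResidueField w))).baseChange ((𝓜.localise w).geomReductionMap (thickeningLift e (S.M.obj Kc) y'')).left).X)
      (_ : IsMonHom qbar),
      (Flat qbar.left ∧ Function.Surjective qbar.left.base) ∧
      (∀ a : 𝓞 F, ((I.act.baseChange (pullback.fst (𝓜.localise w).total.hom (specResidueField w))).baseChange ((𝓜.localise w).geomReductionMap (thickeningLift e (S.M.obj Kc) y)).left).i a ≫ qbar =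
        qbar ≫ (((serreAction I.act E' hE').baseChange (pullback.fst (𝓜.localise w).total.hom (specResidueField w))).baseChange ((𝓜.localise w).geomReductionMap (thickeningLift e (S.M.obj Kc) y'')).left).i a) ∧
      (∀ a : Fin I.g ⊕ Fin I.g → ZMod I.N,
        AlgPoints.map qbar ((I.univ.baseChange (pullback.fst (𝓜.localise w).total.hom (specResidueField w))).restrictPt ((𝓜.localise w).geomReductionMap (thickeningLift e (S.M.obj Kc) y)).left
            (I.univ.sectionBaseChange (pullback.fst (𝓜.localise w).total.hom (specResidueField w)) (I.lvl.section_ a))) =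
          ((serreTensor I.act E' hE').baseChange (pullback.fst (𝓜.localise w).total.hom (specResidueField w))).restrictPt ((𝓜.localise w).geomReductionMap (thickeningLift e (S.M.obj Kc) y'')).left
            ((serreTensor I.act E' hE').sectionBaseChange (pullback.fst (𝓜.localise w).total.hom (specResidueField w)) (I.lvl.section_ a ≫ serreTranslate I.act E' hE' P))) ∧
      (∀ (DBs : (((serreTensor I.act E' hE').baseChange (pullback.fst (𝓜.localise w).total.hom (specResidueField w))).baseChange ((𝓜.localise w).geomReductionMap (thickeningLift e (S.M.obj Kc) y'')).left).DualPair)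
        (_ : Nonempty ((Scheme.Modules.pullback (DualPair.unitHatSlice DBs)).obj DBs.P ≅ SheafOfModules.unit _))
        (lamBs : (((serreTensor I.act E' hE').baseChange (pullback.fst (𝓜.localise w).total.hom (specResidueField w))).baseChange ((𝓜.localise w).geomReductionMap (thickeningLift e (S.M.obj Kc) y'')).left).X ⟶ DBs.hat.X) [IsMonHom lamBs],
        (haveI := isMonHom_coverLeg (pullback.fst (𝓜.localise w).total.hom (specResidueField w)) ((𝓜.localise w).geomReductionMap (thickeningLift e (S.M.obj Kc) y'')).left I.act E' hE' P
         baseChangeHom (baseChangeHom (serreTranslate I.act E' hE' P) (pullback.fst (𝓜.localise w).total.hom (specResidueField w))) ((𝓜.localise w).geomReductionMap (thickeningLift e (S.M.obj Kc) y'')).left ≫ lamBs ≫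
            DualPair.dualIsogenyOver (baseChangeHom (baseChangeHom (serreTranslate I.act E' hE' P) (pullback.fst (𝓜.localise w).total.hom (specResidueField w))) ((𝓜.localise w).geomReductionMap (thickeningLift e (S.M.obj Kc) y'')).left) ((I.dual.baseChange (pullback.fst (𝓜.localise w).total.hom (specResidueField w))).baseChange ((𝓜.localise w).geomReductionMap (thickeningLift e (S.M.obj Kc) y'')).left) DBs =
          ((I.pol.baseChange (pullback.fst (𝓜.localise w).total.hom (specResidueField w))).baseChange ((𝓜.localise w).geomReductionMap (thickeningLift e (S.M.obj Kc) y'')).left).lam ≫ ((I.dual.baseChange (pullback.fst (𝓜.localise w).total.hom (specResidueField w))).baseChange ((𝓜.localise w).geomReductionMap (thickeningLift e (S.M.obj Kc) y'')).left).hat.mulN I.pChar) →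
        qbar ≫ lamBs ≫ DualPair.dualIsogenyOver qbar ((I.dual.baseChange (pullback.fst (𝓜.localise w).total.hom (specResidueField w))).baseChange ((𝓜.localise w).geomReductionMap (thickeningLift e (S.M.obj Kc) y)).left) DBs =
          ((I.pol.baseChange (pullback.fst (𝓜.localise w).total.hom (specResidueField w))).baseChange ((𝓜.localise w).geomReductionMap (thickeningLift e (S.M.obj Kc) y)).left).lam ≫ ((I.dual.baseChange (pullback.fst (𝓜.localise w).total.hom (specResidueField w))).baseChange ((𝓜.localise w).geomReductionMap (thickeningLift e (S.M.obj Kc) y)).left).hat.mulN I.pChar) ∧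
      -- (K3₀) model KILL along a flat `𝒦 ↪ I.univ_ỹ` over `R = 𝒪_Ω̄` (`ỹ := extendPoint … (ℓ_e y)` the `R`-point extending `y` = LS `liftOf`): if `𝒦_η`, read in `A_y` through ★ (d5)'s three-piece
      -- isomorphism (= LS `isoGenericOf` by `hσΩ`), is killed by the LEG `q`, then `𝒦_s`, read in `sch₀Of … (red₀ y)` (= LS `isoSpecialOf` by `hσκ`), is killed by `q̄` — EXACTLY (KEW) `…_of_kerRow`'s `hK3`
      (∀ (𝒦 : Over (Spec (.of (closureValuationSubring (w.adicCompletion F))))) (incl : 𝒦 ⟶ (I.univ.baseChange (extendPoint (closureValuationSubring (w.adicCompletion F)) (toClosureValuationSubring w) (𝓜.localise w).total ((𝓜.localise w).modelPointsEquiv.symm (thickeningLift e (S.M.obj Kc) y))).left).X) [Flat 𝒦.hom],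
        ((Over.pullback (specFractionFieldι (closureValuationSubring (w.adicCompletion F)) (toClosureValuationSubring w)).left).map incl ≫
            (I.univ.fibreBaseChangeIso ((𝓜.localise w).genericIso'.inv.left ≫ pullback.fst (𝓜.localise w).total.hom (specGenericPoint (HeightOneSpectrum.valuationSubringAtPrime F w) F)) (thickeningLift e (S.M.obj Kc) y).left ≪≫ I.univ.fibreCongrPtIso ((𝓜.localise w).left_specFractionFieldι_comp_extendPoint_modelPointsEquiv_symm (thickeningLift e (S.M.obj Kc) y)).symm ≪≫ (I.univ.fibreBaseChangeIso (extendPoint (closureValuationSubring (w.adicCompletion F)) (toClosureValuationSubring w) (𝓜.localise w).total ((𝓜.localise w).modelPointsEquiv.symm (thickeningLift e (S.M.obj Kc) y))).left (specFractionFieldι (closureValuationSubring (w.adicCompletion F)) (toClosureValuationSubring w)).left).symm).inv.hom.hom.hom) ≫ q = 1 →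
        ((Over.pullback ((geomClosedPointIsoSpecResidueField w).inv.left ≫ (specRingHomι (closureValuationSubring (w.adicCompletion F)) (toClosureValuationSubring w) (IsLocalRing.residue (closureValuationSubring (w.adicCompletion F)))).left)).map incl ≫
            (I.univ.fibreBaseChangeIso (pullback.fst (𝓜.localise w).total.hom (specResidueField w)) ((𝓜.localise w).geomReductionMap (thickeningLift e (S.M.obj Kc) y)).left ≪≫ I.univ.fibreCongrPtIso (((𝓜.localise w).left_geomReductionMap_comp_fst (thickeningLift e (S.M.obj Kc) y)).trans (Category.assoc _ _ _).symm) ≪≫ (I.univ.fibreBaseChangeIso (extendPoint (closureValuationSubring (w.adicCompletion F)) (toClosureValuationSubring w) (𝓜.localise w).total ((𝓜.localise w).modelPointsEquiv.symm (thickeningLift e (S.M.obj Kc) y))).left ((geomClosedPointIsoSpecResidueField w).inv.left ≫ (specRingHomι (closureValuationSubring (w.adicCompletion F)) (toClosureValuationSubring w) (IsLocalRing.residue (closureValuationSubring (w.adicCompletion F)))).left)).symm).inv.hom.hom.hom) ≫ qbar = 1) ∧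
      -- (K2₀) for every ideal `𝔞`: `Ker q(Ω̄) ⊆ A_y[𝔞](Ω̄)` on points ⇒ `Ker q̄ ⊆ A_{red₀ y}[𝔞]` on ALL `T`-points (★ currency; `IsIdealTorsionΩ … y 𝔞 Pt` and
      -- `(act₀Of 𝓜 w I.univ I.act r (red₀Of … y)).hom.hom.hom` unfold to the two `.i r` terms by `actΩOf_hom_hom_hom` ∕ `act₀Of_hom_hom_hom` (rfl)); at `𝔞 := 𝔭_w·𝔭_{c•w}` = W3∕W5's `hker`
      (∀ 𝔞 : Ideal (𝓞 F),
        (∀ Pt : ((I.univ.baseChange ((𝓜.localise w).genericIso'.inv.left ≫ pullback.fst (𝓜.localise w).total.hom (specGenericPoint (HeightOneSpectrum.valuationSubringAtPrime F w) F))).baseChange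
            (thickeningLift e (S.M.obj Kc) y).left).toAffine.toAbelianVariety.Points (AlgebraicClosure (w.adicCompletion F)),
          (AlgPoints.map q Pt : B.toAffine.toAbelianVariety.Points (AlgebraicClosure (w.adicCompletion F))) = 1 →
            ∀ r ∈ 𝔞, (AlgPoints.map (((I.act.baseChange ((𝓜.localise w).genericIso'.inv.left ≫ pullback.fst (𝓜.localise w).total.hom (specGenericPoint (HeightOneSpectrum.valuationSubringAtPrime F w) F))).baseChange (thickeningLift e (S.M.obj Kc) y).left).i r) Pt :
              ((I.univ.baseChange ((𝓜.localise w).genericIso'.inv.left ≫ pullback.fst (𝓜.localise w).total.hom (specGenericPoint (HeightOneSpectrum.valuationSubringAtPrime F w) F))).baseChange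
                (thickeningLift e (S.M.obj Kc) y).left).toAffine.toAbelianVariety.Points (AlgebraicClosure (w.adicCompletion F))) = 1) →
        ∀ ⦃T : Over (Spec (.of (geomResidueField w)))⦄ (z : T ⟶ ((I.univ.baseChange (pullback.fst (𝓜.localise w).total.hom (specResidueField w))).baseChange ((𝓜.localise w).geomReductionMap (thickeningLift e (S.M.obj Kc) y)).left).X),
          z ≫ qbar = 1 → ∀ r ∈ 𝔞, z ≫ ((I.act.baseChange (pullback.fst (𝓜.localise w).total.hom (specResidueField w))).baseChange ((𝓜.localise w).geomReductionMap (thickeningLift e (S.M.obj Kc) y)).left).i r = 1) ∧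
      -- (K4₀) degree, (FIN₀) finiteness, (RK₀) `rk Γ(Ker q̄) = #Ker q(Ω̄)` of the reduced leg
      Literature.AlgebraicGeometry.Motives.AbelianVariety.Hom.kerRank (homOfIsMonHom qbar) = Literature.AlgebraicGeometry.Motives.AbelianVariety.Hom.kerRank (homOfIsMonHom q) ∧
      IsFinite qbar.left ∧
      Module.finrank (geomResidueField w) (Literature.AlgebraicGeometry.GroupSchemes.AffineGroupScheme.Alg (Literature.AlgebraicGeometry.GroupSchemes.GroupSchemeKernel.ker qbar)) =
        Nat.card (Literature.AlgebraicGeometry.Motives.AbelianVariety.Hom.kerPoints (specOver (AlgebraicClosure (w.adicCompletion F)) (AlgebraicClosure (w.adicCompletion F))) (homOfIsMonHom q)) ∧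
      -- (IMG-gen) [★ image head (v-c), A-p06 (g36)] IMAGE ∕ FACTORISATION in ROOF currency along a flat `𝒦 ↪ 𝒜_x̃` INTO `c̄(𝒵)` for a model subscheme `ζ : 𝒵 → 𝒜_x̃″` (`x̃″` the `R`-point
      -- extending `x″`) with `ζ ≫ (ψ_P ×_𝓨 x̃″)` a CLOSED immersion: if `incl_η ≫ e⁻¹ ≫ q` factors through `ζ_η ≫ e⁻¹ ≫ c` (LEGS `q`, `c`, target `B`), then `incl_s̄ ≫ e⁻¹ ≫ q̄`
      -- factors through `ζ_s̄ ≫ e⁻¹ ≫ c̄_{x̄″}` (`c̄_{x̄″} = ψ_P` at `x̄″`); three-piece isomorphisms `e` of `𝒜` at `x` and at `x″` explicit, as in (K3-gen)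
      (∀ (𝒦 : Over (Spec (.of (closureValuationSubring (w.adicCompletion F))))) (incl : 𝒦 ⟶ (I.univ.baseChange (extendPoint (closureValuationSubring (w.adicCompletion F)) (toClosureValuationSubring w) (𝓜.localise w).total ((𝓜.localise w).modelPointsEquiv.symm (thickeningLift e (S.M.obj Kc) y))).left).X) [Flat 𝒦.hom]
        (𝒵 : Over (Spec (.of (closureValuationSubring (w.adicCompletion F))))) (ζ : 𝒵 ⟶ (I.univ.baseChange (extendPoint (closureValuationSubring (w.adicCompletion F)) (toClosureValuationSubring w) (𝓜.localise w).total ((𝓜.localise w).modelPointsEquiv.symm (thickeningLift e (S.M.obj Kc) y''))).left).X) [IsClosedImmersion (ζ ≫ baseChangeHom (serreTranslate I.act E' hE' P) (extendPoint (closureValuationSubring (w.adicCompletion F)) (toClosureValuationSubring w) (𝓜.localise w).total ((𝓜.localise w).modelPointsEquiv.symm (thickeningLift e (S.M.obj Kc) y''))).left).left],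
        (∃ m : (Over.pullback (specFractionFieldι (closureValuationSubring (w.adicCompletion F)) (toClosureValuationSubring w)).left).obj 𝒦 ⟶ (Over.pullback (specFractionFieldι (closureValuationSubring (w.adicCompletion F)) (toClosureValuationSubring w)).left).obj 𝒵,
          m ≫ (((Over.pullback (specFractionFieldι (closureValuationSubring (w.adicCompletion F)) (toClosureValuationSubring w)).left).map ζ ≫ (I.univ.fibreBaseChangeIso ((𝓜.localise w).genericIso'.inv.left ≫ pullback.fst (𝓜.localise w).total.hom (specGenericPoint (HeightOneSpectrum.valuationSubringAtPrime F w) F)) (thickeningLift e (S.M.obj Kc) y'').left ≪≫ I.univ.fibreCongrPtIso ((𝓜.localise w).left_specFractionFieldι_comp_extendPoint_modelPointsEquiv_symm (thickeningLift e (S.M.obj Kc) y'')).symm ≪≫ (I.univ.fibreBaseChangeIso (extendPoint (closureValuationSubring (w.adicCompletion F)) (toClosureValuationSubring w) (𝓜.localise w).total ((𝓜.localise w).modelPointsEquiv.symm (thickeningLift e (S.M.obj Kc) y''))).left (specFractionFieldι (closureValuationSubring (w.adicCompletion F)) (toClosureValuationSubring w)).left).symm).inv.hom.hom.hom) ≫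 c) =
            ((Over.pullback (specFractionFieldι (closureValuationSubring (w.adicCompletion F)) (toClosureValuationSubring w)).left).map incl ≫ (I.univ.fibreBaseChangeIso ((𝓜.localise w).genericIso'.inv.left ≫ pullback.fst (𝓜.localise w).total.hom (specGenericPoint (HeightOneSpectrum.valuationSubringAtPrime F w) F)) (thickeningLift e (S.M.obj Kc) y).left ≪≫ I.univ.fibreCongrPtIso ((𝓜.localise w).left_specFractionFieldι_comp_extendPoint_modelPointsEquiv_symm (thickeningLift e (S.M.obj Kc) y)).symm ≪≫ (I.univ.fibreBaseChangeIso (extendPoint (closureValuationSubring (w.adicCompletion F)) (toClosureValuationSubring w) (𝓜.localise w).total ((𝓜.localise w).modelPointsEquiv.symm (thickeningLift e (S.M.obj Kc) y))).left (specFractionFieldι (closureValuationSubring (w.adicCompletion F)) (toClosureValuationSubring w)).left).symm).inv.hom.hom.hom) ≫ q) →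
        ∃ m : (Over.pullback ((geomClosedPointIsoSpecResidueField w).inv.left ≫ (specRingHomι (closureValuationSubring (w.adicCompletion F)) (toClosureValuationSubring w) (IsLocalRing.residue (closureValuationSubring (w.adicCompletion F)))).left)).obj 𝒦 ⟶ (Over.pullback ((geomClosedPointIsoSpecResidueField w).inv.left ≫ (specRingHomι (closureValuationSubring (w.adicCompletion F)) (toClosureValuationSubring w) (IsLocalRing.residue (closureValuationSubring (w.adicCompletion F)))).left)).obj 𝒵,
          m ≫ (((Over.pullback ((geomClosedPointIsoSpecResidueField w).inv.left ≫ (specRingHomι (closureValuationSubring (w.adicCompletion F)) (toClosureValuationSubring w) (IsLocalRing.residue (closureValuationSubring (w.adicCompletion F)))).left)).map ζ ≫ (I.univ.fibreBaseChangeIso (pullback.fst (𝓜.localise w).total.hom (specResidueField w)) ((𝓜.localise w).geomReductionMap (thickeningLift e (S.M.obj Kc) y'')).left ≪≫ I.univ.fibreCongrPtIso (((𝓜.localise w).left_geomReductionMap_comp_fst (thickeningLift e (S.M.obj Kc) y'')).trans (Category.assoc _ _ _).symm) ≪≫ (I.univ.fibreBaseChangeIso (extendPoint (closureValuationSubring (w.adicCompletion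 F)) (toClosureValuationSubring w) (𝓜.localise w).total ((𝓜.localise w).modelPointsEquiv.symm (thickeningLift e (S.M.obj Kc) y''))).left ((geomClosedPointIsoSpecResidueField w).inv.left ≫ (specRingHomι (closureValuationSubring (w.adicCompletion F)) (toClosureValuationSubring w) (IsLocalRing.residue (closureValuationSubring (w.adicCompletion F)))).left)).symm).inv.hom.hom.hom) ≫ baseChangeHom (baseChangeHom (serreTranslate I.act E' hE' P) (pullback.fst (𝓜.localise w).total.hom (specResidueField w))) ((𝓜.localise w).geomReductionMap (thickeningLift e (S.M.obj Kc) y'')).left) =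
            ((Over.pullback ((geomClosedPointIsoSpecResidueField w).inv.left ≫ (specRingHomι (closureValuationSubring (w.adicCompletion F)) (toClosureValuationSubring w) (IsLocalRing.residue (closureValuationSubring (w.adicCompletion F)))).left)).map incl ≫ (I.univ.fibreBaseChangeIso (pullback.fst (𝓜.localise w).total.hom (specResidueField w)) ((𝓜.localise w).geomReductionMap (thickeningLift e (S.M.obj Kc) y)).left ≪≫ I.univ.fibreCongrPtIso (((𝓜.localise w).left_geomReductionMap_comp_fst (thickeningLift e (S.M.obj Kc) y)).trans (Category.assoc _ _ _).symm) ≪≫ (I.univ.fibreBaseChangeIso (extendPoint (closureValuationSubring (w.adicCompletion F)) (toClosureValuationSubring w) (𝓜.localise w).total ((𝓜.localise w).modelPointsEquiv.symm (thickeningLift e (S.M.obj Kc) y))).left ((geomClosedPointIsoSpecResidueField w).inv.left ≫ (specRingHomι (closureValuationSubring (w.adicCompletion F)) (toClosureValuationSubring w) (IsLocalRing.residue (closureValuationSubring (w.adicCompletion F)))).left)).symm).inv.hom.hom.hom) ≫ qbar) :=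
  -- instances come from the binders: the ★ call's instance subterms are the same fvars as the statement's (syntactic unification)
  exists_roofLeg_specialFibre_of_downstairsDual_kerRowsFin_image (K := F) (v := w) (Y := (thickening F Fi).obj (S.M.obj Kc))
    (𝒜 := I.univ) (O := 𝓞 F) (N := I.pChar) (B := B) (J := Fin I.g ⊕ Fin I.g → ZMod I.N) (𝓜.localise w) I.act E' hE' P Q
    (thickeningLift e (S.M.obj Kc) y) (thickeningLift e (S.M.obj Kc) y'') I.dual hD I.pol I.hpChar.1.ne_zero hP hQ hQP hPQ h𝔭
    I.lvl.section_ q c hr2 DB hDBu lamB hr3q hr3c hr4 hr5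

end KernelRowsFinImage

end Summit.HodgeConjecture.HodgeConjecture.Cruxes.HLiu418.F0P6aLineSpecialisation

end
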